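import Summits.AtomisticToContinuum.Crystallization.Theses.ReggeStarCoercivity
import Summits.AtomisticToContinuum.Crystallization.Theses.HullMinimality
import Summits.AtomisticToContinuum.Crystallization.Theorems.DefectFreeCrystallizes.Negative.PredicateAPI
import Summits.AtomisticToContinuum.Crystallization.Theorems.ReggeStarCoercivityDefectFreeCrystallizesTiltedWells
import Summits.AtomisticToContinuum.Crystallization.Theorems.ReggeStarCoercivityDefectFreeCrystallizesHullCriterion
import Summits.AtomisticToContinuum.Crystallization.Theorems.ReggeStarCoercivityDefectFreeCrystallizesPrestressSplit
import Summits.AtomisticToContinuum.Crystallization.Theorems.ReggeStarCoercivityDefectFreeCrystallizesDefs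

/-!
# Line `prestress-split-korn` for crux `ReggeStarCoercivity.DefectFreeCrystallizes`
# (item stmt-AtomisticToContinuum-13603) — CHECKED SKELETON (crux-plan, round 1)

Crux (by name, concluded by `DefectFreeCrystallizes_of` below):
`Summit.AtomisticToContinuum.Crystallization.Theses.ReggeStarCoercivity.DefectFreeCrystallizes`
= `ZeroDefectDensity-for-every-ground-state-sequence → IsCrystallizing lennardJones 3`, the defect
predicate being `PredicateAPI.Good` / `PredicateAPI.defects` VERBATIM (`defectFreeCrystallizes_iff` is
`Iff.rfl`, landed Negative lemma file of the standing disprover).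

The line (idea card `Ideas/prestress-split-korn.md`, triage r1-1/2/3: pass, "one line with own-word-squeeze:
the split is the ENGINE of its step 4"):

  S1 `stub_tiltedWells`        one-variable calculus on V_LJ: tilted STRUT wells are single-welled with an explicit
                               modulus on the funnel window; tilted CABLE wells are flat-concave (explicit tax).
  S2 `stub_funnelRigidity`     potential-free NONLINEAR interior L²-rigidity of the Barlow contact frameworks
                               (free-height layered templates, any Hägg word) for deformations in the funnel:
                               one isometry per half-ball, bond-vector deviations ≤ K · (true strut stretches)², K ≤ 16.
  S3 `stub_localTemplate`      potential-free robust LOCAL template: around a site all of whose 3R-neighbours are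
                               crux-good, particles are labelled by the ideal layered template of some Hägg word, each unit
                               cluster 1/20-close to a similar copy (S2 consumes the looser 1/12, which survives
                               passing to the relaxed template of the same word).
  S4 `stub_splitCoercivity`    THE ENGINE (hardest): S1 → S2 → S3 → `SplitCoercivity` — site-energy coercivity on deep
                               crux-good regions Ω of δ-separated finite configurations, charging c(η) per site whose
                               2-ball is not η-layered, with boundary slack C·#∂_ρΩ and a mesoscopic slack θ·#Ω
                               (prestress split about the relaxed stacking of the local word on balls of radius ρ(θ);
                               linear term = boundary FLUX by zero stress; cables dropped; struts by S1; transverse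
                               strut term by S2; budget |ω₁|·K + τ < c'_min).
  S5 `stub_squeezeToLayered`   the SQUEEZE: `SplitCoercivity` → `LayeredOfZeroDefects` (per ground-state sequence:
                               crux antecedent ⇒ layered windows in the format of `HullMinimality.LayeredWindows`):
                               trial-state bound E(N) ≤ N e* + o(N), 1/3-separation, counting, c(η) vs θ → 0,
                               integration of overlapping local layered fits, compactness in a.
  S6 `stub_periodicGivenLayered`  = `HullMinimality.PeriodicGivenLayered` (stmt-11779) BY NAME (stacking selection;
                               this is where exact minimality selects the stacking — the Disproof's gen-1 verdict).
  S7 `stub_hullCriterion`      = `HullMinimality.HullCriterion` (stmt-3243) BY NAME (provable-now hull glue).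

`composition : S1 → S2 → S3 → S4 → S5a → S5b → S6 → S7 → (crux, unfolded once by PredicateAPI.defectFreeCrystallizes_iff)` is
pure logic (no sorry, no stub used); `DefectFreeCrystallizes_of : DefectFreeCrystallizes` concludes the crux BY NAME by
feeding the seven registered stubs into `composition` — it carries no sorry of its own (sorries live only inside `stub_*`)
and becomes the crux proof the moment the stubs land. (obligation-tag attributes are gate-reserved, hence the hypothesis-free form.)
-/

noncomputable section

open scoped BigOperators Classical InnerProductSpace
open Filter Topology

namespace Summit.AtomisticToContinuum.Crystallization.Cruxes.DefectFreeCrystallizes.PrestressSplitKorn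

open Summit.AtomisticToContinuum.Crystallization.Theses
open Summit.AtomisticToContinuum.Crystallization.Theses.ReggeStarCoercivity
open Summit.AtomisticToContinuum.Crystallization.Theorems.DefectFreeCrystallizes.Negative.PredicateAPI
open Literature.MathematicalPhysics.StatisticalMechanics Literature.Geometry.DiscreteGeometry

local notation "E3" => EuclideanSpace ℝ (Fin 3)

/-! ## Vocabulary and statement blocks

All vocabulary (`layeredPos`, `idealHeights`, `InBox`, `LayeredNear`, `ClusterClose`) and the statement blocks
(`TiltedWells`, `FunnelRigidity`, `LocalTemplate`, `PrestressSplit`, `SplitCoercivity`, `LayeredOfZeroDefects`, `SplitClosure`,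
`SqueezeClosure`, `LayeredGluing`) now live in the LANDED definitions file
`Theorems/ReggeStarCoercivityDefectFreeCrystallizesDefs.lean` (p89772, namespace `…Theorems.PrestressSplitKorn`, opened below),
verbatim as they stood in this skeleton at registration; the stubs below are stated over those importable names, so every landed
stub theorem (same namespace `…Theorems.PrestressSplitKorn`) closes its `sorry` by `exact`. -/

open Summit.AtomisticToContinuum.Crystallization.Theorems.PrestressSplitKorn hiding
  stub_tiltedWells stub_hullCriterion stub_prestressSplit

/-! ## Registered stubs (the only sorries of the file) -/

/-- S1 — CLOSED (landed p75720, `Theorems.PrestressSplitKorn.stub_tiltedWells`). Was: (size M; provable now: monotonicity of `W'(s) = ½s⁻⁴(1 − s⁻³)` below `s = (7/4)^{1/3}`,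
positivity above, and a one-variable modulus estimate on a compact window). Signature spelled out (it is
self-contained over `lennardJones`); `TiltedWells` is the same text (certified by the `example` below). -/
theorem stub_tiltedWells :
    (∀ rs r : ℝ, 24 / 25 ≤ rs → rs ≤ 49 / 50 → 9 / 10 ≤ r → r ≤ 21 / 20 →
        (59 / 20 : ℝ) * (r - rs) ^ 2 ≤
          lennardJones r - lennardJones rs - (rs⁻¹ ^ 7 - rs⁻¹ ^ 13) / (2 * rs) * (r ^ 2 - rs ^ 2)) ∧
    (∀ rs r : ℝ, 19 / 20 ≤ rs → rs ≤ 1 → 4 / 5 ≤ r → r ≤ 6 / 5 →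
        (7 / 8 : ℝ) * (r - rs) ^ 2 ≤
          lennardJones r - lennardJones rs - (rs⁻¹ ^ 7 - rs⁻¹ ^ 13) / (2 * rs) * (r ^ 2 - rs ^ 2)) ∧
    (∀ rs r : ℝ, 6 / 5 ≤ rs → |r - rs| ≤ rs / 10 →
        -(11 / 2 : ℝ) * rs⁻¹ ^ 8 * (r - rs) ^ 2 ≤
          lennardJones r - lennardJones rs - (rs⁻¹ ^ 7 - rs⁻¹ ^ 13) / (2 * rs) * (r ^ 2 - rs ^ 2)) :=
  -- S1 LANDED (p75720): Theorems/ReggeStarCoercivityDefectFreeCrystallizesTiltedWells.lean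
  Summit.AtomisticToContinuum.Crystallization.Theorems.PrestressSplitKorn.stub_tiltedWells

example : TiltedWells := stub_tiltedWells

/-- S2 (size L, potential-free; the constant `K` is what the line's budget spends: `|ω₁|·K + τ < c'_min`). -/
theorem stub_funnelRigidity : FunnelRigidity := by
  sorry

/-- S3 (size L, potential-free; local form of cascade item RobustBarlowTemplate stmt-12088 for the crux's predicate). -/
theorem stub_localTemplate : LocalTemplate := by
  sorry

/-- S4a — the prestress split identity — CLOSED (landed p89386, `Theorems.PrestressSplitKorn.stub_prestressSplit`; was reshaped out of S4 by the lead;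
source work/stubs/stub_prestressSplit.lean — `bond_split`, `sum_linear_eq_forces`, `sum_split`, `sum_linear_eq_boundary`).
Signature spelled out (self-contained over Mathlib); `PrestressSplit` is the same text (certified by the `example`). -/
theorem stub_prestressSplit :
    ∀ (n : ℕ) (W : Fin n → Fin n → ℝ → ℝ) (ω : Fin n → Fin n → ℝ), (∀ i j, ω i j = ω j i) →
    ∀ x y : Fin n → EuclideanSpace ℝ (Fin 3),
      ∑ i, ∑ j, (W i j (‖x j - x i‖ ^ 2) - W i j (‖y j - y i‖ ^ 2)) =
        ∑ i, ∑ j, ((W i j (‖x j - x i‖ ^ 2) - ω i j * ‖x j - x i‖ ^ 2) -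
            (W i j (‖y j - y i‖ ^ 2) - ω i j * ‖y j - y i‖ ^ 2)) +
          ∑ i, ∑ j, ω i j * ‖(x j - x i) - (y j - y i)‖ ^ 2 -
            4 * ∑ i, ⟪∑ j, ω i j • (y j - y i), x i - y i⟫_ℝ :=
  -- S4a LANDED (p89386): Theorems/ReggeStarCoercivityDefectFreeCrystallizesPrestressSplit.lean
  Summit.AtomisticToContinuum.Crystallization.Theorems.PrestressSplitKorn.stub_prestressSplit

example : PrestressSplit := stub_prestressSplit

/-- S4 — THE ENGINE, hardest stub (size XL): the prestress split closes coercivity,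
`PrestressSplit → TiltedWells → FunnelRigidity → LocalTemplate → SplitCoercivity`. -/
theorem stub_splitCoercivity : SplitClosure := by
  sorry

/-- S5a — the gluing lemma (size L; potential-free; reshaped out of S5 after wave 1, see `LayeredGluing`). -/
theorem stub_layeredGluing : LayeredGluing := by
  sorry

/-- S5b — the squeeze MODULO GLUING (size L; twin of PhononSlackCertificates.HullBridge stmt-13961 with the crux's
antecedent in place of the coercive two-shell gap; spends minimality through `E(N)/N → e*` (tree `crysEnergyLimit`)
and `N·e* ≤ E(N)` (tree `card_mul_eStar_le`), `1/3`-separation, counting, compactness in the spacing):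
`LayeredGluing → SplitCoercivity → LayeredOfZeroDefects`. PROVED sorry-free in the lead's folder
(work/stubs/stub_squeezeToLayered.lean, `squeezeToLayered_of_gluing`); lands once the Defs file is in the tree. -/
theorem stub_squeezeToLayered : LayeredGluing → SqueezeClosure := by
  sorry

/-- S6 = item stmt-11779 BY NAME (`HullMinimality.PeriodicGivenLayered`, size L, shared open crux: stacking
selection inside the hull — where exact minimality selects the stacking, the Disproof's gen-1 verdict). -/
theorem stub_periodicGivenLayered : HullMinimality.PeriodicGivenLayered := by
  sorry

/-- S7 = item stmt-3243 BY NAME (`HullMinimality.HullCriterion`) — CLOSED (landed p76335,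
`Theorems.PrestressSplitKorn.stub_hullCriterion`). -/
theorem stub_hullCriterion : HullMinimality.HullCriterion :=
  Summit.AtomisticToContinuum.Crystallization.Theorems.PrestressSplitKorn.stub_hullCriterion

/-! ## The kernel-checked composition -/

/-- **Pure logic of the line** (no sorry, no stub used): S1 → S2 → S3 → S4 → S5 → S6 → S7 → the crux, the latter
written unfolded once (`PredicateAPI.defectFreeCrystallizes_iff` is `Iff.rfl`) so that this documentation theorem is not
itself a by-name candidate. The crux's antecedent, read per sequence, feeds the squeeze; 11779 turns layered windows into
periodic windows; 3243 is the hull criterion. -/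
theorem composition :
    PrestressSplit → TiltedWells → FunnelRigidity → LocalTemplate → SplitClosure → LayeredGluing →
    (LayeredGluing → SqueezeClosure) → HullMinimality.PeriodicGivenLayered → HullMinimality.HullCriterion →
    ((∀ x : (N : ℕ) → (Fin N → E3), (∀ N, IsGroundState lennardJones (x N)) →
        Tendsto (fun N : ℕ => (defects (x N) : ℝ) / N) atTop (𝓝 0)) →
      IsCrystallizing lennardJones 3) := by
  intro h₀ h₁ h₂ h₃ h₄ h₅a h₅b h₆ h₇ hZ
  have hL : LayeredOfZeroDefects := h₅b h₅a (h₄ h₀ h₁ h₂ h₃)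
  exact h₇ fun x hx => h₆ x hx (hL x hx (hZ x hx))

/-- **The line concludes the crux BY NAME.** The seven registered stubs fed into `composition`; no sorry of its own. -/
theorem DefectFreeCrystallizes_of :
    Summit.AtomisticToContinuum.Crystallization.Theses.ReggeStarCoercivity.DefectFreeCrystallizes := by
  rw [defectFreeCrystallizes_iff]
  exact composition stub_prestressSplit stub_tiltedWells stub_funnelRigidity stub_localTemplate stub_splitCoercivity
    stub_layeredGluing stub_squeezeToLayered stub_periodicGivenLayered stub_hullCriterion

end Summit.AtomisticToContinuum.Crystallization.Cruxes.DefectFreeCrystallizes.PrestressSplitKorn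

end
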